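import Literature.NumberTheory.IwasawaTheory.Greenberg2016.LOC2Archimedean
import Literature.NumberTheory.IwasawaTheory.Greenberg2006.TwistDeformation
import Literature.NumberTheory.GaloisRepresentations.ContinuousH1
import HarnessLib

/-!
# Route `EisensteinPrimes` (rung K5), crux 2 `GoodLatticeBDPValue`, line `halves` v5, stub
# `stub_noPseudoNull`, road (γ): `H¹(K_v, 𝐃) = 0` at a COMPLEX place — the archimedean input
# of CRK(`𝐃`, `𝓛_𝔭`) (helper for stmt-BirchSwinnertonDyer-19032)

Cell `bsd-eis`, seat `bsd-eis-k5-c2` (gen 8), k5-c2 lane (planner RULING L55 (A): CRK bookkeeping);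
HOME/k5-c2-MEMO-8.md §3 (CRK) input `harch`. The corank bookkeeping
`GreenbergFullAtSelmer.CRK_fullAt_of_coranks` (`Theorems/EisensteinPrimesGreenbergFullAtCRK.lean`)
asks, at every place of `Σ` other than `𝔭`, `𝔭̄`, that `Q_{𝓛_𝔭}(K_v, 𝐃) = H¹(K_v, 𝐃)` be COTORSION.
At a complex place the local Galois group is trivial (k5-ty
`Greenberg2016.subsingleton_absoluteGaloisGroup_completion_of_isComplex`), and `H¹` of the trivial
group vanishes for ANY coefficients: a continuous crossed homomorphism `φ` has `φ(1) = 0`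
(`contOneCocycles.apply_one`) and every class is represented by a cocycle
(`oneCocycleClass_surjective`, tree `ContinuousH1`). Hence `subsingleton_H_one_of_subsingleton`
(generic `ContinuousRep`), `subsingleton_localH1_inl_of_isComplex`, and the CRK inputs
`isCotorsion_localH1_inl_of_isComplex` / `hasCorank_localH1_inl_zero_of_isComplex`.

Theorems only; no named fact, no `sorry`. HONEST FRAMING: closes nothing by itself (`--supports`).
References: [Greenberg2016Selmer] §2.3 p. 7 (CRK), §1 p. 3 (`Σ ⊇` archimedean places);
J.-P. Serre, *Galois Cohomology* I §2.2 (`H¹` as crossed homomorphisms).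
-/

set_option autoImplicit false
set_option linter.dupNamespace false

noncomputable section

open scoped Classical
open NumberField IsDedekindDomain Field
open Literature.NumberTheory.GaloisRepresentations Literature.NumberTheory.IwasawaTheory.Greenberg2016
  Literature.NumberTheory.IwasawaTheory.Greenberg2006

universe u

namespace Summit.BirchSwinnertonDyer.BirchSwinnertonDyer.Theorems.GreenbergFullAtSelmer

/-- **`H¹` of the trivial group vanishes**: for `G` a singleton, every continuous crossed
homomorphism `φ : G → M` is zero (`φ(1) = 0`), hence principal, so `H¹(G, M) = 0` — any topological
coefficients. [cite: SerreGaloisCohomology1997, I §2.2] -/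
theorem subsingleton_H_one_of_subsingleton {G : Type u} [Group G] [TopologicalSpace G]
    [IsTopologicalGroup G] [Subsingleton G] {Λ : Type u} [CommRing Λ] [TopologicalSpace Λ]
    [IsTopologicalRing Λ] {M : Type u} [AddCommGroup M] [Module Λ M] [TopologicalSpace M]
    [IsTopologicalAddGroup M] [ContinuousSMul Λ M] (τ : ContinuousRep G Λ M) :
    Subsingleton (τ.H 1) := by
  refine ⟨fun x y ↦ ?_⟩
  obtain ⟨φ, rfl⟩ := oneCocycleClass_surjective τ.toTopRep x
  obtain ⟨ψ, rfl⟩ := oneCocycleClass_surjective τ.toTopRep y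
  have hzero : ∀ χ : contOneCocycles τ.toTopRep, oneCocycleClass τ.toTopRep χ = 0 := fun χ ↦
    (oneCocycleClass_eq_zero_iff τ.toTopRep χ).mpr ⟨0, fun g ↦ by
      rw [Subsingleton.elim g 1, contOneCocycles.apply_one, map_zero, sub_zero]⟩
  change oneCocycleClass τ.toTopRep φ = oneCocycleClass τ.toTopRep ψ
  rw [hzero, hzero]

variable {K : Type} [Field K] [NumberField K] (S : Set (HeightOneSpectrum (𝓞 K)))
  {Λ : Type} [CommRing Λ] [TopologicalSpace Λ] [IsTopologicalRing Λ]
  {D : Type} [AddCommGroup D] [Module Λ D] [TopologicalSpace D] [DiscreteTopology D]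
  [ContinuousSMul Λ D] (ρ : ContinuousRep (GaloisGroupUnramifiedOutside K S) Λ D)

/-- **`H¹(K_v, 𝐃) = 0` at a complex place `v`** (`Γ_{K_v} = 1`), for any `𝐃` of Greenberg's arena.
[cite: Greenberg2016Selmer, §1 p. 3 L2–4, §2.3 p. 7] -/
theorem subsingleton_localH1_inl_of_isComplex {w : InfinitePlace K} (hw : w.IsComplex) :
    Subsingleton ((localRep S ρ (Sum.inl w)).H 1) :=
  haveI : Subsingleton (absoluteGaloisGroup (Place.Completion (Sum.inl w : Place K))) :=
    subsingleton_absoluteGaloisGroup_completion_of_isComplex w hw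
  subsingleton_H_one_of_subsingleton _

/-- The archimedean CRK input: `H¹(K_v, 𝐃)` is COTORSION at a complex place (it is zero).
[cite: Greenberg2016Selmer, §2.3 p. 7 L7–17] -/
theorem isCotorsion_localH1_inl_of_isComplex {w : InfinitePlace K} (hw : w.IsComplex) :
    IsCotorsion Λ ((localRep S ρ (Sum.inl w)).H 1) :=
  haveI := subsingleton_localH1_inl_of_isComplex S ρ hw
  isCotorsion_of_subsingleton

/-- `corank H¹(K_v, 𝐃) = 0` at a complex place. [cite: Greenberg2016Selmer, §2.3 p. 7 L5–13] -/
theorem hasCorank_localH1_inl_zero_of_isComplex [Nontrivial Λ] {w : InfinitePlace K}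
    (hw : w.IsComplex) : HasCorank Λ ((localRep S ρ (Sum.inl w)).H 1) 0 :=
  haveI := subsingleton_localH1_inl_of_isComplex S ρ hw
  hasCorank_zero_of_subsingleton

end Summit.BirchSwinnertonDyer.BirchSwinnertonDyer.Theorems.GreenbergFullAtSelmer

end
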